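import Summits.CriticalPhenomena.PercolationContinuityZ3.Theorems.PercNearOneGluingNoHeavyLowerTailKnQuestion8CoefficientwiseOneSided

/-!
# The equality locus of the two-colouring form of vdBHK's Theorem 1.4: parallel composition at `{x, z}` gives exact ties

Support file (`--supports stmt-CriticalPhenomena-4575`, closed), prover `prim-cplus-coupling` (gen 24); companion of `…KnQuestion8CoefficientwiseLeafNA.lean`
(gen 22) and `…KnQuestion8CoefficientwiseOneSided.lean` (gen 24), whose local notation and lemmas are reused.  Memo `prim-cplus-coupling/A5-COUPLING-gen24.md`
§1.2 (and §0(2): in the exhaustive census of all graphs on ≤ 6 vertices every proper tight instance of the two-colouring inequality is explained by this theorem or by a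
cut vertex).  No definitions, no named facts, no sorries; standard axioms.

Setting (as in the companions).  `ends : ι → Sym2 V` a finite multigraph, `t : Finset ι` the red edges, `tᶜ` the blue ones, `CL[t, a]` the red cluster of `a`,
`T(t) := x ∉ cl t z ∧ x ∉ cl tᶜ z`.  Suppose the edge set splits as `A ⊔ Aᶜ` where an edge of `A` and an edge off `A` can only share the vertices `x, z`
("parallel composition of two pieces at `{x,z}`"), and the observer `o ∉ {x, z}` meets no edge of `A`.  Let `Ψ t := (t ∩ Aᶜ) ∪ (A \ t)` swap the colours on `A` only.

* `cl_subset_union_of_sep` — if `z` is reached from `x` neither inside `A` nor inside `Aᶜ`, then the red cluster of `x` is the union of its `A`-part and its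
  `Aᶜ`-part (a red path cannot change sides except at `x` or `z`); in particular no red `x–z` path exists.
* `T_flipSide`, `mem_cl_z_flipSide`, `cl_inter_side`, `apply_cl_flipSide` — under `T`, `Ψ` preserves `T`, preserves `[o ∈ cl t z]`, and exchanges the
  `A`-sides of the red and blue clusters of `x`.
* `twoColouring_parallel_tie` — for every `f : Finset V → ℝ` that reads only vertices of `A`-edges (`f W = f W'` whenever `W, W'` agree on them):
  `Σ_t 1_T(t) · 1[o ∈ cl t z] · (f(cl tᶜ x) − f(cl t x)) = 0`, and (`twoColouring_parallel_tie'`) the same in the original orientation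
  `Σ_t 1_T(t) · f(cl t x) · (1[o ∈ cl tᶜ z] − 1[o ∈ cl t z]) = 0`: the two-colouring form of Thm 1.4 is an EQUALITY for such `f` — the `o`-free parallel route
  contributes nothing, whichever way it is built.
[cite: VandenbergHaggstromKahn2005, Thm. 1.4 (p. 7)]; context [cite: KozmaNitzan2024, Questions 8–9 (§5.5 p. 36)].
-/

noncomputable section

open Finset
open scoped Classical

namespace Summit.CriticalPhenomena.PercolationContinuityZ3.Theorems

namespace CoefficientwiseNA

variable {V : Type*} [Fintype V] [DecidableEq V] {ι : Type*} [Fintype ι] [DecidableEq ι]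

variable (ends : ι → Sym2 V)

/-- The graph of the red edges `t` (as in the companion files; local notation only). -/
local notation "OG[" t "]" => SimpleGraph.fromEdgeSet (Finset.image ends t : Set (Sym2 V))
/-- The red vertex cluster of `a`. -/
local notation "CL[" t ", " a "]" => Finset.filter (fun v => SimpleGraph.Reachable (OG[t]) a v) Finset.univ
/-- Keep the colours on `I`, swap them off `I`. -/
local notation "FLIP[" t ", " I "]" => ((t ∩ I) ∪ (Iᶜ \ t))

omit [Fintype ι] [DecidableEq ι] in
/-- A vertex other than `a` in the red cluster of `a` meets a red edge. [folklore] -/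
theorem exists_edge_of_mem_cl {t : Finset ι} {a v : V} (hv : v ∈ CL[t, a]) (hva : v ≠ a) : ∃ e ∈ t, v ∈ ends e := by
  rw [mem_cl, SimpleGraph.reachable_iff_reflTransGen] at hv
  induction hv with
  | refl => exact absurd rfl hva
  | @tail b c _ hbc _ =>
    obtain ⟨_, e, het, hends⟩ := (og_adj ends).1 hbc
    exact ⟨e, het, by rw [hends]; exact Sym2.mem_mk_right b c⟩

omit [Fintype ι] in
/-- **No side change away from `x`, `z`.**  If an edge of `A` and an edge off `A` can only share the vertices `x, z`, and `z` is reached from `x` neither by red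
edges of `A` alone nor by red edges off `A` alone, then the red cluster of `x` is the union of these two partial clusters. [this work] -/
theorem cl_subset_union_of_sep {A : Finset ι} {x z : V}
    (hsep : ∀ e ∈ A, ∀ e' ∉ A, ∀ v, v ∈ ends e → v ∈ ends e' → v = x ∨ v = z)
    {s : Finset ι} (h1 : z ∉ CL[s ∩ A, x]) (h2 : z ∉ CL[s \ A, x]) :
    CL[s, x] ⊆ CL[s ∩ A, x] ∪ CL[s \ A, x] := by
  intro v hv
  rw [mem_cl, SimpleGraph.reachable_iff_reflTransGen] at hv
  rw [mem_union]
  induction hv with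
  | refl => exact Or.inl (self_mem_cl ends _ x)
  | @tail b c _ hbc ih =>
    obtain ⟨hne, e, hes, hends⟩ := (og_adj ends).1 hbc
    have hbe : b ∈ ends e := by rw [hends]; exact Sym2.mem_mk_left b c
    by_cases heA : e ∈ A
    · -- the step uses an `A`-edge
      have hadjA : (OG[s ∩ A]).Adj b c := (og_adj ends).2 ⟨hne, e, mem_inter.2 ⟨hes, heA⟩, hends⟩
      rcases ih with hb | hb
      · exact Or.inl ((mem_cl ends).2 (((mem_cl ends).1 hb).trans hadjA.reachable))
      · -- `b` reached off `A`: then `b = x` (or `b = z`, excluded)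
        by_cases hbx : b = x
        · subst hbx
          exact Or.inl ((mem_cl ends).2 hadjA.reachable)
        · obtain ⟨e', he's, hbe'⟩ := exists_edge_of_mem_cl ends hb hbx
          have he'A : e' ∉ A := (mem_sdiff.1 he's).2
          rcases hsep e heA e' he'A b hbe hbe' with hb' | hb'
          · exact absurd hb' hbx
          · subst hb'; exact absurd hb h2
    · have hadjB : (OG[s \ A]).Adj b c := (og_adj ends).2 ⟨hne, e, mem_sdiff.2 ⟨hes, heA⟩, hends⟩
      rcases ih with hb | hb
      · by_cases hbx : b = x
        · subst hbx
          exact Or.inr ((mem_cl ends).2 hadjB.reachable)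
        · obtain ⟨e', he's, hbe'⟩ := exists_edge_of_mem_cl ends hb hbx
          have he'A : e' ∈ A := (mem_inter.1 he's).2
          rcases hsep e' he'A e heA b hbe' hbe with hb' | hb'
          · exact absurd hb' hbx
          · subst hb'; exact absurd hb h1
      · exact Or.inr ((mem_cl ends).2 (((mem_cl ends).1 hb).trans hadjB.reachable))

omit [Fintype V] [DecidableEq V] in
/-- The complement of `FLIP[t, I]` is `FLIP[tᶜ, I]`. [folklore] -/
theorem compl_flipOff (t I : Finset ι) : (FLIP[t, I])ᶜ = FLIP[tᶜ, I] := by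
  ext e; simp only [mem_compl, mem_union, mem_inter, mem_sdiff]; tauto

omit [Fintype V] [DecidableEq V] in
/-- `FLIP[·, I]` is an involution. [folklore] -/
theorem flipOff_flipOff (t I : Finset ι) : FLIP[FLIP[t, I], I] = t := by
  ext e; simp only [mem_union, mem_inter, mem_sdiff, mem_compl]; tauto

omit [Fintype V] [DecidableEq V] in
/-- Swapping the colours on `A`: the red `A`-edges afterwards are the blue `A`-edges before. [folklore] -/
theorem flipSide_inter (t A : Finset ι) : FLIP[t, Aᶜ] ∩ A = tᶜ ∩ A := by
  ext e; simp only [mem_union, mem_inter, mem_sdiff, mem_compl, compl_compl]; tauto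

omit [Fintype V] [DecidableEq V] in
/-- Swapping the colours on `A` does not touch the edges off `A`. [folklore] -/
theorem flipSide_sdiff (t A : Finset ι) : FLIP[t, Aᶜ] \ A = t \ A := by
  ext e; simp only [mem_union, mem_inter, mem_sdiff, mem_compl, compl_compl]; tauto

omit [Fintype V] [DecidableEq V] in
/-- Swapping the colours on `A`: the blue `A`-edges afterwards are the red `A`-edges before. [folklore] -/
theorem compl_flipSide_inter (t A : Finset ι) : (FLIP[t, Aᶜ])ᶜ ∩ A = t ∩ A := by
  ext e; simp only [mem_union, mem_inter, mem_sdiff, mem_compl, compl_compl]; tauto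

section Parallel

variable {A : Finset ι} {x z o : V}
  (hsep : ∀ e ∈ A, ∀ e' ∉ A, ∀ v, v ∈ ends e → v ∈ ends e' → v = x ∨ v = z)

include hsep

omit [Fintype ι] in
/-- Under a two-sided disconnection the red cluster of `x` splits along the two sides. [this work] -/
theorem cl_subset_union_of_T {t : Finset ι} (ht : z ∉ CL[t, x]) : CL[t, x] ⊆ CL[t ∩ A, x] ∪ CL[t \ A, x] :=
  cl_subset_union_of_sep ends hsep (fun h => ht (cl_mono ends inter_subset_left x h))
    (fun h => ht (cl_mono ends sdiff_subset x h))

/-- `Ψ t := FLIP[t, Aᶜ]` (swap the colours on `A` only) creates no red `x–z` path if `t` has no red and no blue one. [this work] -/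
theorem not_mem_cl_flipSide {t : Finset ι} (h1 : z ∉ CL[t, x]) (h2 : z ∉ CL[tᶜ, x]) : z ∉ CL[FLIP[t, Aᶜ], x] := by
  have hA : FLIP[t, Aᶜ] ∩ A = tᶜ ∩ A := flipSide_inter t A
  have hB : FLIP[t, Aᶜ] \ A = t \ A := flipSide_sdiff t A
  intro hz
  have hz' := cl_subset_union_of_sep ends hsep (s := FLIP[t, Aᶜ])
    (by rw [hA]; exact fun h => h2 (cl_mono ends inter_subset_left x h))
    (by rw [hB]; exact fun h => h1 (cl_mono ends sdiff_subset x h)) hz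
  rw [mem_union, hA, hB] at hz'
  rcases hz' with h | h
  · exact h2 (cl_mono ends inter_subset_left x h)
  · exact h1 (cl_mono ends sdiff_subset x h)

/-- `Ψ` preserves the two-sided disconnection `T`. [this work] -/
theorem T_flipSide {t : Finset ι} (hT : x ∉ CL[t, z] ∧ x ∉ CL[tᶜ, z]) :
    x ∉ CL[FLIP[t, Aᶜ], z] ∧ x ∉ CL[(FLIP[t, Aᶜ])ᶜ, z] := by
  have h1 : z ∉ CL[t, x] := (not_mem_cl_comm ends).1 hT.1
  have h2 : z ∉ CL[tᶜ, x] := (not_mem_cl_comm ends).1 hT.2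
  refine ⟨(not_mem_cl_comm ends).2 (not_mem_cl_flipSide ends hsep h1 h2), (not_mem_cl_comm ends).2 ?_⟩
  rw [compl_flipOff]
  exact not_mem_cl_flipSide ends hsep h2 (by rw [compl_compl]; exact h1)

omit [Fintype ι] in
/-- Under `T`, whether `o` (which meets no `A`-edge) lies in the red cluster of `z` is decided off `A`. [this work] -/
theorem mem_cl_z_iff_sdiff (ho : ∀ e ∈ A, o ∉ ends e) (hoz : o ≠ z) {t : Finset ι} (hT : x ∉ CL[t, z]) :
    o ∈ CL[t, z] ↔ o ∈ CL[t \ A, z] := by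
  constructor
  · intro h
    have hsep' : ∀ e ∈ A, ∀ e' ∉ A, ∀ v, v ∈ ends e → v ∈ ends e' → v = z ∨ v = x :=
      fun e he e' he' v hv hv' => (hsep e he e' he' v hv hv').symm
    have hsplit := cl_subset_union_of_sep ends hsep' (s := t) (x := z) (z := x)
      (fun h' => hT (cl_mono ends inter_subset_left z h')) (fun h' => hT (cl_mono ends sdiff_subset z h')) h
    rcases mem_union.1 hsplit with h' | h'
    · obtain ⟨e, he, hoe⟩ := exists_edge_of_mem_cl ends h' hoz
      exact absurd hoe (ho e (mem_inter.1 he).2)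
    · exact h'
  · exact fun h => cl_mono ends sdiff_subset z h

/-- Under `T`, `Ψ` does not change whether `o` lies in the red cluster of `z`. [this work] -/
theorem mem_cl_z_flipSide (ho : ∀ e ∈ A, o ∉ ends e) (hoz : o ≠ z) {t : Finset ι} (hT : x ∉ CL[t, z] ∧ x ∉ CL[tᶜ, z]) :
    o ∈ CL[FLIP[t, Aᶜ], z] ↔ o ∈ CL[t, z] := by
  have hT' := T_flipSide ends hsep hT
  rw [mem_cl_z_iff_sdiff ends hsep ho hoz hT'.1, mem_cl_z_iff_sdiff ends hsep ho hoz hT.1]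
  rw [flipSide_sdiff t A]

omit [Fintype ι] in
/-- Under `T`, the vertices of `A`-edges in the red cluster of `x` are those reached inside `A`. [this work] -/
theorem cl_inter_side {t : Finset ι} (hT : x ∉ CL[t, z]) {v : V} (hv : ∃ e ∈ A, v ∈ ends e) :
    v ∈ CL[t, x] ↔ v ∈ CL[t ∩ A, x] := by
  constructor
  · intro h
    by_cases hvx : v = x
    · subst hvx; exact self_mem_cl ends _ v
    have hsplit := cl_subset_union_of_T ends hsep ((not_mem_cl_comm ends).1 hT) h
    rcases mem_union.1 hsplit with h' | h'
    · exact h'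
    · obtain ⟨e', he', hve'⟩ := exists_edge_of_mem_cl ends h' hvx
      obtain ⟨e, he, hve⟩ := hv
      rcases hsep e he e' (mem_sdiff.1 he').2 v hve hve' with h'' | h''
      · exact absurd h'' hvx
      · subst h''
        exact absurd (cl_mono ends sdiff_subset x h') ((not_mem_cl_comm ends).1 hT)
  · exact fun h => cl_mono ends inter_subset_left x h

/-- Under `T`, a functional reading only the vertices of `A`-edges sees, after `Ψ`, the BLUE cluster of `x` in place of the red one. [this work] -/
theorem apply_cl_flipSide (f : Finset V → ℝ)
    (hf : ∀ W W' : Finset V, (∀ v, (∃ e ∈ A, v ∈ ends e) → (v ∈ W ↔ v ∈ W')) → f W = f W')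
    {t : Finset ι} (hT : x ∉ CL[t, z] ∧ x ∉ CL[tᶜ, z]) :
    f (CL[FLIP[t, Aᶜ], x]) = f (CL[tᶜ, x]) ∧ f (CL[(FLIP[t, Aᶜ])ᶜ, x]) = f (CL[t, x]) := by
  have hT' := T_flipSide ends hsep hT
  have hA : FLIP[t, Aᶜ] ∩ A = tᶜ ∩ A := flipSide_inter t A
  have hA' : (FLIP[t, Aᶜ])ᶜ ∩ A = t ∩ A := compl_flipSide_inter t A
  constructor
  · refine hf _ _ fun v hv => ?_
    rw [cl_inter_side ends hsep hT'.1 hv, cl_inter_side ends hsep hT.2 hv, hA]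
  · refine hf _ _ fun v hv => ?_
    rw [cl_inter_side ends hsep hT'.2 hv, cl_inter_side ends hsep hT.1 hv, hA']

/-- **Exact ties from parallel composition at `{x, z}` (swapped orientation).**  If the edges split as `A ⊔ Aᶜ` with `A`-edges and non-`A`-edges sharing only
the vertices `x, z`, the observer `o ≠ z` meets no `A`-edge, and `f` reads only vertices of `A`-edges, then
`Σ_t 1_T(t) · 1[o ∈ cl t z] · (f(cl tᶜ x) − f(cl t x)) = 0`.  (Memo A5-COUPLING-gen24 §1.2: the involution "swap the colours on `A`" preserves `T` and
`[o ∈ cl t z]` and exchanges the two clusters of `x` on `A`.) [this work] -/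
theorem twoColouring_parallel_tie (ho : ∀ e ∈ A, o ∉ ends e) (hoz : o ≠ z) (f : Finset V → ℝ)
    (hf : ∀ W W' : Finset V, (∀ v, (∃ e ∈ A, v ∈ ends e) → (v ∈ W ↔ v ∈ W')) → f W = f W') :
    ∑ t : Finset ι, (if x ∉ CL[t, z] ∧ x ∉ CL[tᶜ, z]
      then (if o ∈ CL[t, z] then (1 : ℝ) else 0) * (f (CL[tᶜ, x]) - f (CL[t, x])) else 0) = 0 := by
  set Φ : Finset ι → ℝ := fun t => if x ∉ CL[t, z] ∧ x ∉ CL[tᶜ, z]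
      then (if o ∈ CL[t, z] then (1 : ℝ) else 0) * (f (CL[tᶜ, x]) - f (CL[t, x])) else 0 with hΦ
  -- `Φ (Ψ t) = − Φ t`
  have hneg : ∀ t : Finset ι, Φ (FLIP[t, Aᶜ]) = -Φ t := by
    intro t
    by_cases hT : x ∉ CL[t, z] ∧ x ∉ CL[tᶜ, z]
    · have hT' := T_flipSide ends hsep hT
      obtain ⟨e1, e2⟩ := apply_cl_flipSide ends hsep f hf hT
      simp only [hΦ]
      rw [if_pos hT', if_pos hT, e1, e2]
      have ho' : (o ∈ CL[FLIP[t, Aᶜ], z]) ↔ (o ∈ CL[t, z]) := mem_cl_z_flipSide ends hsep ho hoz hT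
      by_cases hoz' : o ∈ CL[t, z]
      · rw [if_pos (ho'.2 hoz'), if_pos hoz']; ring
      · rw [if_neg (fun h => hoz' (ho'.1 h)), if_neg hoz']; ring
    · have hT' : ¬(x ∉ CL[FLIP[t, Aᶜ], z] ∧ x ∉ CL[(FLIP[t, Aᶜ])ᶜ, z]) := by
        intro h
        have := T_flipSide ends hsep h
        rw [flipOff_flipOff] at this
        exact hT this
      simp only [hΦ]
      rw [if_neg hT', if_neg hT, neg_zero]
  -- reindex the sum by the involution
  have hsum : ∑ t : Finset ι, Φ t = ∑ t : Finset ι, Φ (FLIP[t, Aᶜ]) := by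
    refine (Finset.sum_bij' (fun t _ => FLIP[t, Aᶜ]) (fun t _ => FLIP[t, Aᶜ]) (fun _ _ => mem_univ _) (fun _ _ => mem_univ _)
      (fun t _ => flipOff_flipOff t Aᶜ) (fun t _ => flipOff_flipOff t Aᶜ) ?_)
    intro t _
    rw [flipOff_flipOff]
  have h2 : ∑ t : Finset ι, Φ (FLIP[t, Aᶜ]) = -∑ t : Finset ι, Φ t := by
    rw [← Finset.sum_neg_distrib]
    exact Finset.sum_congr rfl fun t _ => hneg t
  have : ∑ t : Finset ι, Φ t = -∑ t : Finset ι, Φ t := hsum.trans h2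
  show ∑ t : Finset ι, Φ t = 0
  linarith

/-- **Exact ties from parallel composition at `{x, z}` (original orientation of the two-colouring form of Thm 1.4).**  Under the hypotheses of
`twoColouring_parallel_tie`:  `Σ_t 1_T(t) · f(cl t x) · (1[o ∈ cl tᶜ z] − 1[o ∈ cl t z]) = 0` — the two-colouring (coefficientwise) vdBHK-1.4 inequality is an
equality for every functional of the red cluster of `x` that only reads the `o`-free parallel route. [cite: VandenbergHaggstromKahn2005, Thm. 1.4 (p. 7)] -/
theorem twoColouring_parallel_tie' (ho : ∀ e ∈ A, o ∉ ends e) (hoz : o ≠ z) (f : Finset V → ℝ)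
    (hf : ∀ W W' : Finset V, (∀ v, (∃ e ∈ A, v ∈ ends e) → (v ∈ W ↔ v ∈ W')) → f W = f W') :
    ∑ t : Finset ι, (if x ∉ CL[t, z] ∧ x ∉ CL[tᶜ, z]
      then f (CL[t, x]) * ((if o ∈ CL[tᶜ, z] then (1 : ℝ) else 0) - (if o ∈ CL[t, z] then (1 : ℝ) else 0)) else 0) = 0 := by
  -- global colour swap on the cross term
  have swap : ∀ H : Finset ι → ℝ, ∑ t : Finset ι, H tᶜ = ∑ t : Finset ι, H t := fun H =>
    Fintype.sum_bijective _ (compl_involutive (α := Finset ι)).bijective (fun t => H tᶜ) H fun _ => rfl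
  have e1 : ∑ t : Finset ι, (if x ∉ CL[t, z] ∧ x ∉ CL[tᶜ, z] then f (CL[t, x]) * (if o ∈ CL[tᶜ, z] then (1 : ℝ) else 0) else 0)
      = ∑ t : Finset ι, (if x ∉ CL[t, z] ∧ x ∉ CL[tᶜ, z] then f (CL[tᶜ, x]) * (if o ∈ CL[t, z] then (1 : ℝ) else 0) else 0) := by
    rw [← swap (fun t => if x ∉ CL[t, z] ∧ x ∉ CL[tᶜ, z] then f (CL[tᶜ, x]) * (if o ∈ CL[t, z] then (1 : ℝ) else 0) else 0)]
    refine Finset.sum_congr rfl fun t _ => ?_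
    simp only [compl_compl]
    exact if_congr and_comm rfl rfl
  have hsplit : ∀ t : Finset ι, (if x ∉ CL[t, z] ∧ x ∉ CL[tᶜ, z]
      then f (CL[t, x]) * ((if o ∈ CL[tᶜ, z] then (1 : ℝ) else 0) - (if o ∈ CL[t, z] then (1 : ℝ) else 0)) else 0)
      = (if x ∉ CL[t, z] ∧ x ∉ CL[tᶜ, z] then f (CL[t, x]) * (if o ∈ CL[tᶜ, z] then (1 : ℝ) else 0) else 0)
        - (if x ∉ CL[t, z] ∧ x ∉ CL[tᶜ, z] then f (CL[t, x]) * (if o ∈ CL[t, z] then (1 : ℝ) else 0) else 0) := by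
    intro t; split_ifs <;> ring
  have hjoin : ∀ t : Finset ι, (if x ∉ CL[t, z] ∧ x ∉ CL[tᶜ, z] then f (CL[tᶜ, x]) * (if o ∈ CL[t, z] then (1 : ℝ) else 0) else 0)
        - (if x ∉ CL[t, z] ∧ x ∉ CL[tᶜ, z] then f (CL[t, x]) * (if o ∈ CL[t, z] then (1 : ℝ) else 0) else 0)
      = (if x ∉ CL[t, z] ∧ x ∉ CL[tᶜ, z]
          then (if o ∈ CL[t, z] then (1 : ℝ) else 0) * (f (CL[tᶜ, x]) - f (CL[t, x])) else 0) := by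
    intro t; split_ifs <;> ring
  rw [Finset.sum_congr rfl fun t _ => hsplit t, Finset.sum_sub_distrib, e1, ← Finset.sum_sub_distrib,
    Finset.sum_congr rfl fun t _ => hjoin t]
  exact twoColouring_parallel_tie ends hsep ho hoz f hf

end Parallel

end CoefficientwiseNA

end Summit.CriticalPhenomena.PercolationContinuityZ3.Theorems
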